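import Literature.Topology.PlanarFoliations.WalkLeafPaths
import Literature.Topology.PlanarFoliations.WalkBuild
import Literature.Topology.PlanarFoliations.WalkErasure
import Literature.Topology.FourManifolds.TautFoliationsFenceVanishing
import HarnessLib

/-!
# The pieces of the polygon of a cycle as a walk of leaf paths; null-homotopy of its composite

Topic: Topology / PlanarFoliations, sequel to `WalkLeafPaths.lean` (the image of a walk as paths
of `T.LeafSpace`; the base loop as a conjugate of the chain of steps), `WalkBuild.lean` (the walk
`walkJ`, `walkℓ` around a cycle of separatrices), `PolygonLoop.lean` / `PolygonLeafPath.lean` (its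
polygon `polyTrace`, pieces `piece i`, leaf loop `polyLeafLoop`) and `WalkErasure.lean` (abstract
walks of paths). For a cycle of separatrices we package the images of the pieces as paths
`gPiece k : pos (vtx (idx k)) ⟶ pos (vtx (idx (k + 1)))` of the leaf space of `T`, assemble them
into the **walk of pieces** `polyWalk n : Walk pos (vtx (idx 0)) (vtx (idx n))` (an abstract walk
placed by `pos`, ready for loop erasure) and prove:

* `stepP_eq_gPiece`: the step of the walk fence's base from puncture to puncture *is* the image of
  the piece (after removing the constant ends of the link): same prongs, same link;
* `comp_polyWalk`: the composite of the walk of pieces is homotopic to the chain of steps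
  `chainL`, and to a path reading `g ∘ polyTrace` (`exists_path_polyTrace`);
* `exists_base_null_of_comp_polyWalk`: **if the composite of the walk of pieces over a period is
  homotopic to a constant path, the base loop of the walk fence is null-homotopic** — with
  `HugDegree.walkBase_not_null` this makes the composite essential;
* `polyLeafLoop_null_iff`: the leaf loop of the polygon is null-homotopic iff the composite of the
  walk of pieces is homotopic to a constant path.

All statements are [folklore].
-/

noncomputable section

open Set Filter Function Metric unitInterval
open _root_.Topology
open Literature.Topology.FourManifolds Literature.Topology.FourManifolds.Foliation

namespace Literature.Topology.PlanarFoliations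

variable {X : Type*} [TopologicalSpace X] [T2Space X] [SecondCountableTopology X] [Nonempty X] {F : Foliation ℝ X} {ι : X → ℂ}
variable {B : Type*} [NormedAddCommGroup B] {M : Type*} [TopologicalSpace M] {T : Foliation B M} {g : ℂ → M}
variable {hbi : IsBiOriented F}

namespace StarData

variable (D : StarData F ι T g) (hι : IsOpenEmbedding ι)
variable {m : ℕ} [NeZero m] {C : Set ℂ} (hC : IsCompact C) {vtx : Fin m → ℂ} {sx : Fin m → X}
  [hnc : ∀ i, NoncompactSpace (F.Leaf (sx i))]
  (hv : ∀ i, vtx i ∈ D.P) (hmem : ∀ i, ∀ q : F.Leaf (sx i), ι (Leaf.pt q) ∈ C)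
  (hω : ∀ i, omegaSet hbi ι (sx i) = {vtx i}) (hα : ∀ i, alphaSet hbi ι (sx (i + 1)) = {vtx i})

/-! ## The pieces as paths of the leaf space -/

/-- **The image of the piece `idx k` of the polygon** as a path of the leaf space of `T` from
`pos (vtx (idx k))` to `pos (vtx (idx (k + 1)))`. [folklore] -/
def gPiece (k : ℕ) : Path (D.pos (D.walkJ hι hC hv hmem hω hα k).v) (D.pos (D.walkJ hι hC hv hmem hω hα (k + 1)).v) where
  toFun := toLeafSpace ∘ (g ∘ D.piece hι hC hv hmem hω hα (idx m k))
  continuous_toFun := D.continuous_toLeafSpace_g_piece hι hC hv hmem hω hα (idx m k)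
  source' := by simp only [comp_apply, piece_zero]; rfl
  target' := by simp only [comp_apply, piece_one, ← idx_succ]; rfl

/-- The puncture of the junction `k` of the walk. [folklore] -/
@[simp] theorem walkJ_v (k : ℕ) : (D.walkJ hι hC hv hmem hω hα k).v = vtx (idx m k) := rfl

/-- The values of the image of a piece. [folklore] -/
theorem gPiece_apply (k : ℕ) (θ : I) : D.gPiece hι hC hv hmem hω hα k θ = toLeafSpace (g (D.piece hι hC hv hmem hω hα (idx m k) θ)) := rfl

/-- The in-prong path of the junction `i + 1` is the image of the incoming arc of the piece `i`.
[folklore] -/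
theorem inP_cycJ_succ_apply (i : Fin m) (θ : I) :
    (D.cycJ hι hC hv hmem hω hα (i + 1)).inP θ = toLeafSpace (g (D.inArc hι hC hv hmem hω hα i θ)) := by
  rw [WalkJunction.inP_apply]
  show toLeafSpace (g ((D.star (vtx (i + 1)) _).pt (D.jc hι hC hv hmem hω hα (i + 1)).Ef.j (βline (D.jc hι hC hv hmem hω hα (i + 1)).β 0 θ, 0))) =
    toLeafSpace (g ((D.star (vtx (i + 1)) _).pt (D.jc hι hC hv hmem hω hα (i + 1)).Ef.j ((1 - (θ : ℝ)) * (D.jc hι hC hv hmem hω hα (i + 1)).β, 0)))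
  congr 4
  unfold βline; ring

/-- The out-prong path of the junction `i` is the image of the outgoing arc of the piece `i`.
[folklore] -/
theorem outP_cycJ_apply (i : Fin m) (θ : I) :
    (D.cycJ hι hC hv hmem hω hα i).outP θ = toLeafSpace (g (D.outArc hι hC hv hmem hω hα i θ)) := by
  rw [WalkJunction.outP_apply]
  show toLeafSpace (g ((D.star (vtx i) _).pt (D.jc hι hC hv hmem hω hα i).Eb.j (βline 0 (D.jc hι hC hv hmem hω hα i).β θ, 0))) =
    toLeafSpace (g ((D.star (vtx i) _).pt (D.jc hι hC hv hmem hω hα i).Eb.j ((θ : ℝ) * (D.jc hι hC hv hmem hω hα i).β, 0)))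
  congr 4
  unfold βline; ring

/-- **The step of the walk from puncture to puncture, without the constant ends of its link, is
the image of the piece.** [folklore] -/
theorem stepP_eq_gPiece (k : ℕ) :
    ((D.walkJ hι hC hv hmem hω hα k).outP.trans
        (D.ℓT (D.walkJ hι hC hv hmem hω hα) (D.walkℓ hι hC hv hmem hω hα) (D.continuous_toLeafSpace_walkℓ hι hC hv hmem hω hα) k)).trans
      (D.walkJ hι hC hv hmem hω hα (k + 1)).inP = D.gPiece hι hC hv hmem hω hα k := by
  apply Path.eq_of_forall_eq
  intro θ
  rw [gPiece_apply, Path.trans_apply_eq_transFun, piece, ← transFun_map (fun z ↦ (toLeafSpace (g z) : T.LeafSpace))]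
  refine transFun_congr (fun θ' ↦ ?_) (fun θ' ↦ ?_) θ
  · rw [Path.trans_apply_eq_transFun, ← transFun_map (fun z ↦ (toLeafSpace (g z) : T.LeafSpace))]
    refine transFun_congr (fun θ'' ↦ D.outP_cycJ_apply hι hC hv hmem hω hα (idx m k) θ'') (fun θ'' ↦ rfl) θ'
  · have h := D.walkJ_succ hι hC hv hmem hω hα k
    show (D.walkJ hι hC hv hmem hω hα (k + 1)).inP θ' = _
    rw [h]
    exact D.inP_cycJ_succ_apply hι hC hv hmem hω hα (idx m k) θ'

/-- The step of the walk is homotopic to the image of the piece. [folklore] -/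
theorem stepP_homotopic_gPiece (k : ℕ) :
    (D.stepP (D.walkJ hι hC hv hmem hω hα) (D.walkℓ hι hC hv hmem hω hα) (D.continuous_toLeafSpace_walkℓ hι hC hv hmem hω hα) k).Homotopic
      (D.gPiece hι hC hv hmem hω hα k) := by
  rw [← D.stepP_eq_gPiece hι hC hv hmem hω hα k, stepP]
  exact ((Path.Homotopic.refl _).hcomp (D.linkP_homotopic _ _ _ k)).hcomp (Path.Homotopic.refl _)

/-! ## The walk of pieces -/

/-- **The product of the images of the pieces**, left-nested, from `pos (vtx (idx 0))`. [folklore] -/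
def gTraceL : (n : ℕ) → Path (D.pos (D.walkJ hι hC hv hmem hω hα 0).v) (D.pos (D.walkJ hι hC hv hmem hω hα n).v)
  | 0 => Path.refl _
  | n + 1 => (gTraceL n).trans (D.gPiece hι hC hv hmem hω hα n)

/-- The chain of steps of the walk is homotopic to the product of the images of the pieces.
[folklore] -/
theorem chainL_homotopic_gTraceL (n : ℕ) :
    (D.chainL (D.walkJ hι hC hv hmem hω hα) (D.walkℓ hι hC hv hmem hω hα) (D.continuous_toLeafSpace_walkℓ hι hC hv hmem hω hα) n).Homotopic
      (D.gTraceL hι hC hv hmem hω hα n) := by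
  induction n with
  | zero => exact Path.Homotopic.refl _
  | succ n ih => exact ih.hcomp (D.stepP_homotopic_gPiece hι hC hv hmem hω hα n)

/-- **The walk of pieces** around the cycle: the abstract walk of the leaf paths `gPiece k`,
`k < n`, placed by `pos`. [folklore] -/
def polyWalk : (n : ℕ) → Walk D.pos (D.walkJ hι hC hv hmem hω hα 0).v (D.walkJ hι hC hv hmem hω hα n).v
  | 0 => Walk.nil _
  | n + 1 => (polyWalk n).append (Walk.cons (D.gPiece hι hC hv hmem hω hα n) (Walk.nil _))

/-- The length of the walk of pieces. [folklore] -/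
@[simp] theorem length_polyWalk (n : ℕ) : (D.polyWalk hι hC hv hmem hω hα n).length = n := by
  induction n with
  | zero => rfl
  | succ n ih => rw [polyWalk, Walk.length_append, ih]; rfl

/-- **The darts of the walk of pieces.** [folklore] -/
theorem darts_polyWalk (n : ℕ) :
    (D.polyWalk hι hC hv hmem hω hα n).Darts =
      {d | ∃ k < n, d = ⟨(D.walkJ hι hC hv hmem hω hα k).v, (D.walkJ hι hC hv hmem hω hα (k + 1)).v, D.gPiece hι hC hv hmem hω hα k⟩} := by
  induction n with
  | zero =>
    ext d; simp [polyWalk]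
  | succ n ih =>
    rw [polyWalk, Walk.darts_append, ih, Walk.darts_cons, Walk.darts_nil, insert_empty_eq]
    ext d
    simp only [mem_union, mem_setOf_eq, mem_singleton_iff]
    constructor
    · rintro (⟨k, hk, rfl⟩ | rfl)
      · exact ⟨k, Nat.lt_succ_of_lt hk, rfl⟩
      · exact ⟨n, n.lt_succ_self, rfl⟩
    · rintro ⟨k, hk, rfl⟩
      rcases Nat.lt_succ_iff_lt_or_eq.1 hk with h | h
      · exact Or.inl ⟨k, h, rfl⟩
      · subst h; exact Or.inr rfl

/-- **The source list of the walk of pieces**: the punctures `vtx (idx k)`, `k < n`. [folklore] -/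
theorem srcList_polyWalk (n : ℕ) : (D.polyWalk hι hC hv hmem hω hα n).srcList = (List.range n).map (fun k ↦ (D.walkJ hι hC hv hmem hω hα k).v) := by
  induction n with
  | zero => rfl
  | succ n ih => rw [polyWalk, Walk.srcList_append, ih, List.range_succ, List.map_append]; rfl

/-- **The composite of the walk of pieces is the product of the images of the pieces**, up to
homotopy. [folklore] -/
theorem comp_polyWalk (n : ℕ) : (D.polyWalk hι hC hv hmem hω hα n).comp.Homotopic (D.gTraceL hι hC hv hmem hω hα n) := by
  induction n with
  | zero => exact Path.Homotopic.refl _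
  | succ n ih =>
    rw [polyWalk]
    refine (Walk.comp_append _ _).trans ?_
    simp only [Walk.comp_cons, Walk.comp_nil]
    exact ih.hcomp (Path.Homotopic.trans_refl' _)

/-- The composite of the walk of pieces is homotopic to the chain of steps of the walk. [folklore] -/
theorem comp_polyWalk_homotopic_chainL (n : ℕ) :
    (D.polyWalk hι hC hv hmem hω hα n).comp.Homotopic
      (D.chainL (D.walkJ hι hC hv hmem hω hα) (D.walkℓ hι hC hv hmem hω hα) (D.continuous_toLeafSpace_walkℓ hι hC hv hmem hω hα) n) :=
  (D.comp_polyWalk hι hC hv hmem hω hα n).trans (D.chainL_homotopic_gTraceL hι hC hv hmem hω hα n).symm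

/-- **If the composite of the walk of pieces over a period is homotopic to a constant path, the
base loop of the walk fence is null-homotopic.** [folklore] -/
theorem exists_base_null_of_comp_polyWalk (R : Path (D.pos (D.walkJ hι hC hv hmem hω hα 0).v) (D.pos (D.walkJ hι hC hv hmem hω hα m).v))
    (hR : ∀ θ, R θ = D.pos (vtx (idx m 0)))
    (h : (D.polyWalk hι hC hv hmem hω hα m).comp.Homotopic R) :
    ∃ (p : T.LeafSpace) (L : Path p p),
      (∀ θ, L θ = toLeafSpace (D.walkBase (D.walkJ hι hC hv hmem hω hα) (D.walkℓ hι hC hv hmem hω hα) m θ)) ∧ L.Homotopic (Path.refl p) :=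
  D.exists_base_null_of_chain _ _ _ (D.walkJ_period hι hC hv hmem hω hα) R hR ((D.comp_polyWalk_homotopic_chainL hι hC hv hmem hω hα m).symm.trans h)

/-! ## The leaf loop of the polygon and the walk of pieces -/

/-- A path reading `g ∘ polyTrace k`, homotopic to the product of the first `k + 1` pieces.
[folklore] -/
theorem exists_path_polyTrace (k : ℕ) :
    ∃ Pk : Path (D.pos (D.walkJ hι hC hv hmem hω hα 0).v) (D.pos (D.walkJ hι hC hv hmem hω hα (k + 1)).v),
      (∀ θ, Pk θ = toLeafSpace (g (D.polyTrace hι hC hv hmem hω hα k θ))) ∧ (D.gTraceL hι hC hv hmem hω hα (k + 1)).Homotopic Pk := by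
  induction k with
  | zero => exact ⟨D.gPiece hι hC hv hmem hω hα 0, fun θ ↦ rfl, Path.Homotopic.refl_trans' _⟩
  | succ k ih =>
    obtain ⟨Pk, hPk, hhom⟩ := ih
    refine ⟨Pk.trans (D.gPiece hι hC hv hmem hω hα (k + 1)), fun θ ↦ ?_, hhom.hcomp (Path.Homotopic.refl _)⟩
    rw [Path.trans_apply_eq_transFun, polyTrace_succ, ← transFun_map (fun z ↦ (toLeafSpace (g z) : T.LeafSpace))]
    exact transFun_congr hPk (fun θ' ↦ rfl) θ

/-- **The leaf loop of the polygon is null-homotopic iff the composite of the walk of pieces is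
homotopic to a constant path.** [folklore] -/
theorem polyLeafLoop_null_iff :
    (D.polyLeafLoop hι hC hv hmem hω hα).Homotopic (Path.refl _) ↔
      ∃ R : Path (D.pos (D.walkJ hι hC hv hmem hω hα 0).v) (D.pos (D.walkJ hι hC hv hmem hω hα m).v), (∀ θ, R θ = D.pos (vtx (idx m 0))) ∧
        (D.polyWalk hι hC hv hmem hω hα m).comp.Homotopic R := by
  obtain ⟨n, rfl⟩ : ∃ n, m = n + 1 := ⟨m - 1, (Nat.sub_add_cancel NeZero.one_le).symm⟩
  obtain ⟨Pk, hPk, hhom⟩ := D.exists_path_polyTrace hι hC hv hmem hω hα n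
  have hend : D.pos (D.walkJ hι hC hv hmem hω hα 0).v = D.pos (D.walkJ hι hC hv hmem hω hα (n + 1)).v := by rw [walkJ_period]
  -- the leaf loop, read as a path with the ends of `Pk`
  have hsame : ∀ θ, D.polyLeafLoop hι hC hv hmem hω hα θ = (Pk.cast rfl hend) θ := fun θ ↦ by
    rw [polyLeafLoop_apply]; exact (hPk θ).symm
  have hcomp := D.comp_polyWalk hι hC hv hmem hω hα (n + 1)
  constructor
  · intro hnull
    refine ⟨(Path.refl _).cast rfl hend.symm, fun θ ↦ rfl, ?_⟩
    have h1 : (Pk.cast rfl hend).Homotopic (Path.refl _) :=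
      (Path.homotopic_refl_iff_of_forall_eq (ℓ₁ := D.polyLeafLoop hι hC hv hmem hω hα) (ℓ₂ := Pk.cast rfl hend) hsame).1 hnull
    have h2 : ((Pk.cast rfl hend).cast rfl hend.symm).Homotopic ((Path.refl _).cast rfl hend.symm) :=
      Path.Homotopic.cast' h1 rfl hend.symm
    exact (hcomp.trans hhom).trans h2
  · rintro ⟨R, hR, hR'⟩
    have hPkR : Pk.Homotopic R := (hcomp.trans hhom).symm.trans hR'
    have h1 : (Pk.cast rfl hend).Homotopic (R.cast rfl hend) := Path.Homotopic.cast' hPkR rfl hend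
    have h2 : R.cast rfl hend = Path.refl _ := Path.eq_refl_of_forall_eq hR
    rw [h2] at h1
    exact (Path.homotopic_refl_iff_of_forall_eq (ℓ₁ := D.polyLeafLoop hι hC hv hmem hω hα) (ℓ₂ := Pk.cast rfl hend) hsame).2 h1

end StarData

end Literature.Topology.PlanarFoliations
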